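import Literature.Analysis.FluidPDE.AxisymQuotientRayAverage
import Literature.Analysis.FluidPDE.HouLeiLiSupBound
import HarnessLib

/-!
# The Hou–Li variables of an `H^∞` field: `L²` membership of the quotients and their derivatives;
# the sup bound `‖uʳ/r‖_∞ ≲ ‖Ω‖₂^{1/2} ‖∂_zΩ‖₂^{1/2}` without integrability provisos

Analysis/FluidPDE support file (all results proved; no definitions, no named facts) on the
decomposition path of the named fact
`Literature.Analysis.FluidPDE.LeiZhang2017_smallSwirl_regularity` (Lei–Zhang 2017, Thm. 1.4).

`HouLeiLiEstimate` / `HouLeiLiSupBound` prove Lemma 2.1 of Lei–Zhang 2017 and its consequence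
`‖uʳ/r‖_{L^∞} ≤ C_A (‖ω^θ/r‖_{L²} ‖∂_z(ω^θ/r)‖_{L²})^{1/2}` (p. 10) for an axisymmetric
divergence-free `u` under fourteen explicit `L²` hypotheses on `ρ = uʳ/r`, `ω₁ = ω^θ/r` and their
derivatives.  By `AxisymQuotientRayAverage` (`∫ ‖Dⁿρ‖² ≤ ‖curlCLM‖² ∫ ‖Dⁿ⁺¹u‖²`,
`∫ ‖Dⁿω₁‖² ≤ ‖curlCLM‖⁴ ∫ ‖Dⁿ⁺²u‖²`) all of them hold as soon as `u ∈ C^∞` has all `L²` Sobolev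
norms finite (`H^∞`, e.g. every slice of a Tao-class solution):

* `memLp_two_of_norm_le_of_lintegral`, `norm_iteratedFDeriv_fderiv_apply_le_vec3` — bookkeeping:
  `L²` membership from a pointwise bound by a function with `∫ ‖·‖² < ∞`, and
  `‖Dᵏ(∂ᵥf)‖ ≤ ‖v‖ ‖Dᵏ⁺¹f‖`;
* `memLp_of_sobolev`, `memLp_fderiv_apply_of_sobolev`, `memLp_fderiv_fderiv_apply_of_sobolev`,
  `memLp_fderiv_fderiv_fderiv_apply_of_sobolev`, `memLp_radDerivQuot_of_sobolev`,
  `memLp_radDerivQuot_fderiv_apply_of_sobolev`, `IsAxisymmetricScalar.memLp_coord_mul_fderiv_radDerivQuot_of_sobolev`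
  — for a scalar `f ∈ C^∞ ∩ H^∞` (axisymmetric for the last one): `f`, `∂ᵢf`, `∂ⱼ∂ᵢf`, `∂ₖ∂ⱼ∂ᵢf`,
  `(∂ᵣf)/r`, `(∂ᵣ∂ᵢf)/r`, `xᵢ∂ᵢ((∂ᵣf)/r) = ∂ᵢ∂ᵢf − (∂ᵣf)/r` are in `L²`;
* `IsAxisymmetric.abs_radVelQuot_le_of_sobolev` — **`|uʳ/r (x)| ≤ C_A (∫ ω₁² · ∫ (∂_zω₁)²)^{1/4}`**
  for every axisymmetric divergence-free `u ∈ C^∞ ∩ H^∞`, `C_A = √N + Λ C_S` the absolute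
  constant of `HouLeiLiSupBound` (Lei–Zhang 2017, p. 10, from Lemma 2.1 + Agmon).

## Mathlib / tree search

Tree: `IsAxisymmetric.abs_radVelQuot_le` (`HouLeiLiSupBound`), `memLp_radDerivQuot_of_memLp`
(`RadialQuotientSobolev`), `radDerivQuot_add_mul_fderiv_eq` (`HouLeiLiEstimate`),
`IsAxisymmetric.lintegral_sq_iteratedFDeriv_radVelQuot_le / _angVortQuot_le`
(`AxisymQuotientRayAverage`), `eLpNorm_two_lt_top_of_lintegral_enorm_sq_lt_top`
(`EnstrophySplitting`), `contDiff_fderiv_apply_const_succ` (`AxisymmetricLiftR5`).  Mathlib: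
`norm_iteratedFDeriv_clm_apply_const`, `norm_iteratedFDeriv_fderiv`, `norm_iteratedFDeriv_zero`,
`MemLp.of_le`, `EuclideanSpace.norm_single`.

## References

* Z. Lei, Q. S. Zhang, Pacific J. Math. 289 (2017) = arXiv:1505.02628, Lemma 2.1 and §4 (p. 10).
  [LeiZhang2017]
* T. Y. Hou, Z. Lei, C. Li, Comm. PDE 33 (2008), Lemma (elliptic estimate for `uʳ/r`). [folklore]
-/

noncomputable section

open MeasureTheory Set Function Filter Topology
open scoped ENNReal NNReal ContDiff

namespace Literature.Analysis.FluidPDE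

/-! ### Bookkeeping -/

section General

variable {G H : Type*} [NormedAddCommGroup G] [NormedAddCommGroup H]

/-- `L²` membership from a pointwise bound `‖g‖ ≤ ‖F‖` by a function with `∫ ‖F‖² < ∞`
(`g` continuous). [folklore] -/
theorem memLp_two_of_norm_le_of_lintegral {g : EuclideanSpace ℝ (Fin 3) → G}
    {F : EuclideanSpace ℝ (Fin 3) → H} (hg : Continuous g) (hle : ∀ x, ‖g x‖ ≤ ‖F x‖)
    (hfin : ∫⁻ x, ‖F x‖ₑ ^ 2 < ⊤) : MemLp g 2 volume := by
  refine ⟨hg.aestronglyMeasurable, eLpNorm_two_lt_top_of_lintegral_enorm_sq_lt_top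
    (lt_of_le_of_lt (lintegral_mono fun x => ?_) hfin)⟩
  gcongr
  rw [← ofReal_norm, ← ofReal_norm]
  exact ENNReal.ofReal_le_ofReal (hle x)

/-- **`‖Dᵏ(∂ᵥf)‖ ≤ ‖v‖ ‖Dᵏ⁺¹f‖`** for `f ∈ C^∞`. [folklore] -/
theorem norm_iteratedFDeriv_fderiv_apply_le_vec3 {F' : Type*} [NormedAddCommGroup F'] [NormedSpace ℝ F']
    {f : EuclideanSpace ℝ (Fin 3) → F'} (hf : ContDiff ℝ ∞ f) (v : EuclideanSpace ℝ (Fin 3))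
    (k : ℕ) (x : EuclideanSpace ℝ (Fin 3)) :
    ‖iteratedFDeriv ℝ k (fun y => fderiv ℝ f y v) x‖ ≤ ‖v‖ * ‖iteratedFDeriv ℝ (k + 1) f x‖ := by
  have hD : ContDiff ℝ ∞ (fderiv ℝ f) := hf.fderiv_right (m := ∞) (by simp)
  calc ‖iteratedFDeriv ℝ k (fun y => fderiv ℝ f y v) x‖
      ≤ ‖v‖ * ‖iteratedFDeriv ℝ k (fderiv ℝ f) x‖ :=
        norm_iteratedFDeriv_clm_apply_const hD.contDiffAt (by exact_mod_cast le_top)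
    _ = ‖v‖ * ‖iteratedFDeriv ℝ (k + 1) f x‖ := by rw [norm_iteratedFDeriv_fderiv]

/-- `∂ᵥf ∈ C^∞` for `f ∈ C^∞`. [folklore] -/
theorem contDiff_fderiv_apply_vec3_of_contDiff {F' : Type*} [NormedAddCommGroup F'] [NormedSpace ℝ F']
    {f : EuclideanSpace ℝ (Fin 3) → F'} (hf : ContDiff ℝ ∞ f) (v : EuclideanSpace ℝ (Fin 3)) :
    ContDiff ℝ ∞ fun y => fderiv ℝ f y v := by
  have hf1 : ContDiff ℝ ((⊤ : ℕ∞) + 1 : ℕ∞) f := by simpa using hf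
  exact contDiff_fderiv_apply_const_succ (n := (⊤ : ℕ∞)) hf1 v

end General

/-! ### A scalar `f ∈ C^∞ ∩ H^∞`: `L²` membership of its derivatives and radial quotients -/

section ScalarSobolev

variable {f : EuclideanSpace ℝ (Fin 3) → ℝ}

/-- `f ∈ L²`. [folklore] -/
theorem memLp_of_sobolev (hf : ContDiff ℝ ∞ f)
    (hfin : ∀ n : ℕ, ∫⁻ x, ‖iteratedFDeriv ℝ n f x‖ₑ ^ 2 < ⊤) : MemLp f 2 volume :=
  memLp_two_of_norm_le_of_lintegral hf.continuous
    (fun x => (norm_iteratedFDeriv_zero (𝕜 := ℝ) (f := f) (x := x)).symm.le) (hfin 0)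

/-- `∂ᵥf ∈ L²` (`‖v‖ ≤ 1`). [folklore] -/
theorem memLp_fderiv_apply_of_sobolev (hf : ContDiff ℝ ∞ f)
    (hfin : ∀ n : ℕ, ∫⁻ x, ‖iteratedFDeriv ℝ n f x‖ₑ ^ 2 < ⊤) {v : EuclideanSpace ℝ (Fin 3)}
    (hv : ‖v‖ ≤ 1) : MemLp (fun x => fderiv ℝ f x v) 2 volume := by
  refine memLp_two_of_norm_le_of_lintegral (contDiff_fderiv_apply_vec3_of_contDiff hf v).continuous
    (fun x => ?_) (hfin 1)
  have h := norm_iteratedFDeriv_fderiv_apply_le_vec3 hf v 0 x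
  rw [norm_iteratedFDeriv_zero] at h
  calc _ ≤ ‖v‖ * ‖iteratedFDeriv ℝ 1 f x‖ := h
    _ ≤ 1 * ‖iteratedFDeriv ℝ 1 f x‖ := mul_le_mul_of_nonneg_right hv (norm_nonneg _)
    _ = _ := one_mul _

/-- The Sobolev finiteness passes to `∂ᵥf` (`‖v‖ ≤ 1`). [folklore] -/
theorem lintegral_sq_iteratedFDeriv_fderiv_apply_lt_top (hf : ContDiff ℝ ∞ f)
    (hfin : ∀ n : ℕ, ∫⁻ x, ‖iteratedFDeriv ℝ n f x‖ₑ ^ 2 < ⊤) {v : EuclideanSpace ℝ (Fin 3)}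
    (hv : ‖v‖ ≤ 1) (n : ℕ) :
    ∫⁻ x, ‖iteratedFDeriv ℝ n (fun y => fderiv ℝ f y v) x‖ₑ ^ 2 < ⊤ := by
  refine lt_of_le_of_lt (lintegral_mono fun x => ?_) (hfin (n + 1))
  gcongr
  rw [← ofReal_norm, ← ofReal_norm]
  refine ENNReal.ofReal_le_ofReal ((norm_iteratedFDeriv_fderiv_apply_le_vec3 hf v n x).trans ?_)
  calc _ ≤ 1 * ‖iteratedFDeriv ℝ (n + 1) f x‖ := mul_le_mul_of_nonneg_right hv (norm_nonneg _)
    _ = _ := one_mul _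

/-- `∂_w∂ᵥf ∈ L²` (`‖v‖, ‖w‖ ≤ 1`). [folklore] -/
theorem memLp_fderiv_fderiv_apply_of_sobolev (hf : ContDiff ℝ ∞ f)
    (hfin : ∀ n : ℕ, ∫⁻ x, ‖iteratedFDeriv ℝ n f x‖ₑ ^ 2 < ⊤) {v w : EuclideanSpace ℝ (Fin 3)}
    (hv : ‖v‖ ≤ 1) (hw : ‖w‖ ≤ 1) :
    MemLp (fun x => fderiv ℝ (fun y => fderiv ℝ f y v) x w) 2 volume :=
  memLp_fderiv_apply_of_sobolev (contDiff_fderiv_apply_vec3_of_contDiff hf v)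
    (lintegral_sq_iteratedFDeriv_fderiv_apply_lt_top hf hfin hv) hw

/-- `∂ₛ∂_w∂ᵥf ∈ L²` (`‖v‖, ‖w‖, ‖s‖ ≤ 1`). [folklore] -/
theorem memLp_fderiv_fderiv_fderiv_apply_of_sobolev (hf : ContDiff ℝ ∞ f)
    (hfin : ∀ n : ℕ, ∫⁻ x, ‖iteratedFDeriv ℝ n f x‖ₑ ^ 2 < ⊤) {v w s : EuclideanSpace ℝ (Fin 3)}
    (hv : ‖v‖ ≤ 1) (hw : ‖w‖ ≤ 1) (hs : ‖s‖ ≤ 1) :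
    MemLp (fun x => fderiv ℝ (fun z => fderiv ℝ (fun y => fderiv ℝ f y v) z w) x s) 2 volume :=
  memLp_fderiv_fderiv_apply_of_sobolev (contDiff_fderiv_apply_vec3_of_contDiff hf v)
    (lintegral_sq_iteratedFDeriv_fderiv_apply_lt_top hf hfin hv) hw hs

/-- The unit coordinate vectors have norm `≤ 1`. [folklore] -/
theorem norm_euclideanSpace_single_one_le (i : Fin 3) :
    ‖(EuclideanSpace.single i (1 : ℝ) : EuclideanSpace ℝ (Fin 3))‖ ≤ 1 := by
  simp

/-- `(∂ᵣf)/r ∈ L²` and `radQuot f ∈ L²` for `f ∈ C^∞ ∩ H^∞`. [folklore] -/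
theorem memLp_radDerivQuot_of_sobolev (hf : ContDiff ℝ ∞ f)
    (hfin : ∀ n : ℕ, ∫⁻ x, ‖iteratedFDeriv ℝ n f x‖ₑ ^ 2 < ⊤) :
    MemLp (radDerivQuot f) 2 volume ∧ MemLp (radQuot f) 2 volume :=
  memLp_radDerivQuot_of_memLp (contDiff_infty.1 hf 2)
    (memLp_fderiv_fderiv_apply_of_sobolev hf hfin (norm_euclideanSpace_single_one_le 0)
      (norm_euclideanSpace_single_one_le 0))

/-- `(∂ᵣ∂ᵥf)/r ∈ L²` for `f ∈ C^∞ ∩ H^∞` (`‖v‖ ≤ 1`). [folklore] -/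
theorem memLp_radDerivQuot_fderiv_apply_of_sobolev (hf : ContDiff ℝ ∞ f)
    (hfin : ∀ n : ℕ, ∫⁻ x, ‖iteratedFDeriv ℝ n f x‖ₑ ^ 2 < ⊤) {v : EuclideanSpace ℝ (Fin 3)}
    (hv : ‖v‖ ≤ 1) : MemLp (radDerivQuot fun y => fderiv ℝ f y v) 2 volume :=
  (memLp_radDerivQuot_of_sobolev (contDiff_fderiv_apply_vec3_of_contDiff hf v)
    (lintegral_sq_iteratedFDeriv_fderiv_apply_lt_top hf hfin hv)).1

/-- **`xᵢ ∂ᵢ((∂ᵣf)/r) ∈ L²`** (`i = 0, 1`) for an axisymmetric scalar `f ∈ C^∞ ∩ H^∞`: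
`xᵢ ∂ᵢq = ∂ᵢ∂ᵢf − q` (`radDerivQuot_add_mul_fderiv_eq`). [folklore] -/
theorem IsAxisymmetricScalar.memLp_coord_mul_fderiv_radDerivQuot_of_sobolev
    (hax : IsAxisymmetricScalar f) (hf : ContDiff ℝ ∞ f)
    (hfin : ∀ n : ℕ, ∫⁻ x, ‖iteratedFDeriv ℝ n f x‖ₑ ^ 2 < ⊤) {i : Fin 3} (hi : i = 0 ∨ i = 1) :
    MemLp (fun x => x i * fderiv ℝ (radDerivQuot f) x (EuclideanSpace.single i 1)) 2 volume := by
  have h3 : ContDiff ℝ 3 f := contDiff_infty.1 hf 3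
  have heq : (fun x => x i * fderiv ℝ (radDerivQuot f) x (EuclideanSpace.single i 1)) =
      fun x => fderiv ℝ (fun y => fderiv ℝ f y (EuclideanSpace.single i 1)) x
        (EuclideanSpace.single i 1) - radDerivQuot f x := by
    funext x
    have h := radDerivQuot_add_mul_fderiv_eq h3 hax hi x
    linarith
  rw [heq]
  exact (memLp_fderiv_fderiv_apply_of_sobolev hf hfin (norm_euclideanSpace_single_one_le i)
    (norm_euclideanSpace_single_one_le i)).sub (memLp_radDerivQuot_of_sobolev hf hfin).1

end ScalarSobolev

/-! ### The Hou–Li variables of an axisymmetric `u ∈ C^∞ ∩ H^∞` -/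

section Quotients

variable {u : EuclideanSpace ℝ (Fin 3) → EuclideanSpace ℝ (Fin 3)}

/-- `ρ = uʳ/r ∈ C^∞ ∩ H^∞` for an axisymmetric `u ∈ C^∞ ∩ H^∞`. [folklore] -/
theorem IsAxisymmetric.lintegral_sq_iteratedFDeriv_radVelQuot_lt_top (hax : IsAxisymmetric u)
    (hu : ContDiff ℝ ∞ u) (hH : ∀ n : ℕ, ∫⁻ x, ‖iteratedFDeriv ℝ n u x‖ₑ ^ 2 < ⊤) (n : ℕ) :
    ∫⁻ x, ‖iteratedFDeriv ℝ n (radVelQuot u) x‖ₑ ^ 2 < ⊤ :=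
  lt_of_le_of_lt (hax.lintegral_sq_iteratedFDeriv_radVelQuot_le hu n)
    (ENNReal.mul_lt_top ENNReal.ofReal_lt_top (hH (n + 1)))

/-- `ω₁ = ω^θ/r ∈ C^∞ ∩ H^∞` for an axisymmetric `u ∈ C^∞ ∩ H^∞`. [folklore] -/
theorem IsAxisymmetric.lintegral_sq_iteratedFDeriv_angVortQuot_lt_top (hax : IsAxisymmetric u)
    (hu : ContDiff ℝ ∞ u) (hH : ∀ n : ℕ, ∫⁻ x, ‖iteratedFDeriv ℝ n u x‖ₑ ^ 2 < ⊤) (n : ℕ) :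
    ∫⁻ x, ‖iteratedFDeriv ℝ n (angVortQuot u) x‖ₑ ^ 2 < ⊤ :=
  lt_of_le_of_lt (hax.lintegral_sq_iteratedFDeriv_angVortQuot_le hu n)
    (ENNReal.mul_lt_top ENNReal.ofReal_lt_top (hH (n + 2)))

/-- `u₁ = u^θ/r ∈ C^∞ ∩ H^∞` for an axisymmetric `u ∈ C^∞ ∩ H^∞`. [folklore] -/
theorem IsAxisymmetric.lintegral_sq_iteratedFDeriv_angVelQuot_lt_top (hax : IsAxisymmetric u)
    (hu : ContDiff ℝ ∞ u) (hH : ∀ n : ℕ, ∫⁻ x, ‖iteratedFDeriv ℝ n u x‖ₑ ^ 2 < ⊤) (n : ℕ) :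
    ∫⁻ x, ‖iteratedFDeriv ℝ n (angVelQuot u) x‖ₑ ^ 2 < ⊤ :=
  lt_of_le_of_lt (hax.lintegral_sq_iteratedFDeriv_angVelQuot_le hu n)
    (ENNReal.mul_lt_top ENNReal.ofReal_lt_top (hH (n + 1)))

/-- **`‖uʳ/r‖_{L^∞} ≤ C_A ‖Ω‖_{L²}^{1/2} ‖∂_zΩ‖_{L²}^{1/2}` in `H^∞`** (Lei–Zhang 2017, p. 10, from
Lemma 2.1 and the Agmon inequality): for every axisymmetric divergence-free `u ∈ C^∞` with all
`L²` Sobolev norms finite, pointwise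
`|radVelQuot u x| ≤ C_A (∫ (angVortQuot u)² · ∫ (∂₂ angVortQuot u)²)^{1/4}`,
`C_A = √N + Λ C_S` the absolute constant of `IsAxisymmetric.abs_radVelQuot_le`, all of whose `L²`
provisos are discharged here. [cite: LeiZhang2017, §4 (p. 10) and Lemma 2.1] -/
theorem IsAxisymmetric.abs_radVelQuot_le_of_sobolev (hax : IsAxisymmetric u)
    (hu : ContDiff ℝ ∞ u) (hdiv : VectorCalculus.IsDivFree u)
    (hH : ∀ n : ℕ, ∫⁻ x, ‖iteratedFDeriv ℝ n u x‖ₑ ^ 2 < ⊤) (x : EuclideanSpace ℝ (Fin 3)) :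
    |radVelQuot u x| ≤ (Real.sqrt newtonNearSqInt + newtonFarLaplacianL65 *
        SNormLESNormFDerivOfEqConst ℝ (volume : Measure (EuclideanSpace ℝ (Fin 3))) 2) *
      ((∫ y, angVortQuot u y ^ 2) *
        ∫ y, fderiv ℝ (angVortQuot u) y (EuclideanSpace.single 2 1) ^ 2) ^ (1 / 4 : ℝ) := by
  have hρ : ContDiff ℝ ∞ (radVelQuot u) := contDiff_radVelQuot_of_contDiff hu
  have hω : ContDiff ℝ ∞ (angVortQuot u) := contDiff_angVortQuot_of_contDiff hu
  have hρfin := hax.lintegral_sq_iteratedFDeriv_radVelQuot_lt_top hu hH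
  have hωfin := hax.lintegral_sq_iteratedFDeriv_angVortQuot_lt_top hu hH
  have hρax : IsAxisymmetricScalar (radVelQuot u) :=
    hax.isAxisymmetricScalar_radVelQuot (contDiff_infty.1 hu 2)
  have he := norm_euclideanSpace_single_one_le
  exact hax.abs_radVelQuot_le (contDiff_infty.1 hu 5) hdiv (memLp_of_sobolev hρ hρfin)
    (memLp_radDerivQuot_of_sobolev hρ hρfin).1
    (memLp_fderiv_apply_of_sobolev hρ hρfin (he 0))
    (memLp_fderiv_apply_of_sobolev hρ hρfin (he 1))
    (memLp_fderiv_apply_of_sobolev hρ hρfin (he 2))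
    (memLp_fderiv_fderiv_apply_of_sobolev hρ hρfin (he 0) (he 0))
    (memLp_fderiv_fderiv_apply_of_sobolev hρ hρfin (he 1) (he 1))
    (memLp_fderiv_fderiv_apply_of_sobolev hρ hρfin (he 2) (he 2))
    (hρax.memLp_coord_mul_fderiv_radDerivQuot_of_sobolev hρ hρfin (Or.inl rfl))
    (hρax.memLp_coord_mul_fderiv_radDerivQuot_of_sobolev hρ hρfin (Or.inr rfl))
    (memLp_radDerivQuot_fderiv_apply_of_sobolev hρ hρfin (he 2))
    (memLp_of_sobolev hω hωfin) (memLp_fderiv_apply_of_sobolev hω hωfin (he 2)) x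

end Quotients

end Literature.Analysis.FluidPDE

end
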